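import Summits.SmoothPoincare4.SmoothPoincare4.Theorems.ConvexBisectionAcyclicBisectionExistsDualHandleModelImage
import HarnessLib

/-!
# Dual handles, XIII: the image of the dual boundary sphere is the zero set of `H` in the handle
(brick (F-bdry) of the sub-goal T3b "the complement of the prefix sub-handlebody is the other
piece with the DUAL suffix handles" of stub `stub_steinRealisation` (NF6), line
`modp-braid-orbits` r11, crux `ConvexBisection.AcyclicBisectionExists`,
item stmt-SmoothPoincare4-10508; wave 3, lead c5, worker Z2)

Sequel of `…DualHandleModelImage.lean` (`𝓕 (D⁴ ∖ S) = Dome ∪ N`; see also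
`…DualHandleModelRegion.lean`: `N = {‖x‖ ≤ 1, H ≤ 0, P ≤ 3κ²/4}`, regularity of `{H = 0}`).
On the dual boundary sphere `∂D⁴ ∖ S = {‖z‖ = 1, ‖z_λ‖² < 1}` one has `u = 1`, so its image is
the curve `u = 1` of the quarter-plane map `Λ`: `(𝓅(s), δ s)` for `s ≤ 1/2` (the graph
`P = 𝓅(Q/δ)` and the line `δP = κ²Q`), `(κ² s, 𝒸(κ² s))` for `s ≥ 1/2` (the curve `Q = 𝒸(P)`,
running into the seam `P + Q = 1` for `s ≥ 3/4`) — exactly the zero set of the model function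
`H` in the handle below `P = κ²` (V5 report §3.1 (F-bdry)):

* `seamZero_of_param`, `param_of_seamZero` — the two inclusions read in the quarter plane;
* **`image_modelF_sphere_eq`:
  `modelF a κ δ '' {‖z‖ = 1, ‖z_λ‖² < 1} = {x | ‖x‖ ≤ 1 ∧ H x = 0 ∧ ‖x_λ‖² < κ²}`**
  (registered as `helper_image_modelF_sphere`) — the future boundary `∂W₂ = ∂X₁'` near the belt
  circle: the seam part `{‖x‖ = 1, 3κ²/4 ≤ ‖x_λ‖² < κ²}` (`modelH_neg_of_seam`,
  `seamZero_iff_of_norm_eq_one`) together with `∂N ∩ {‖x‖ < 1}`;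
* **`dualDome_eq_range_dualVec`: `Dome = Π(T)` exactly** (explicit inverse `g⁻¹ w = 2w/(a + 2w)`), the
  fact step (iv) uses to see that `E := D₂.jA` meets the dual ranges exactly over the domes.

Constants: `0 < a`, `0 < κ ≤ 1/2`, `0 < δ ≤ 1/2`.  Everything here is proved; no named facts.

## References
* J. Milnor, *Lectures on the h-cobordism theorem* (1965), §3 (dual handles). [MilnorHCobordism1965]
-/

noncomputable section

-- the prescribed namespace `Summit.<P>.<Sub>.…` duplicates `SmoothPoincare4` (P = Sub)
set_option linter.dupNamespace false

open scoped Manifold ContDiff Topology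

namespace Summit.SmoothPoincare4.SmoothPoincare4.Theorems.AcyclicBisectionExists.ModpBraidOrbits

open Set Function Metric
open Literature.Topology.FourManifolds Literature.Topology.FourManifolds.HandleAttachingMap

/-! ### §1 The curve `u = 1` read in the quarter plane -/

section Plane

/-- On the dual boundary sphere (off `S`), `u = 1`. [folklore] -/
theorem uOf_eq_one_of_norm_eq_one {z : EuclideanSpace ℝ (Fin 4)} (hz : ‖z‖ = 1) (hs : sOf z < 1) :
    uOf z = 1 := by
  rw [uOf, div_eq_one_iff_eq (by linarith : (1 : ℝ) - sOf z ≠ 0)]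
  have h := norm_sq_eq_lamPart_muPart z
  rw [hz, one_pow] at h
  unfold sOf; linarith

/-- **The curve `u = 1` lies in `{P + Q ≤ 1, h = 0, P < κ²}`.** [cite: MilnorHCobordism1965, §3] -/
theorem seamZero_of_param {a κ δ : ℝ} (hκ : 0 < κ) (hκ2 : κ ≤ 1 / 2) (hδ : 0 < δ) (hδ2 : δ ≤ 1 / 2)
    {s P Q : ℝ} (hs1 : s < 1) (hP : P = pFun κ s) (hQ : Q = s * qTilde a κ δ s 1) :
    P + Q ≤ 1 ∧ modelHFun κ δ P Q = 0 ∧ P < κ ^ 2 := by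
  have hκ2' : 0 < κ ^ 2 := by positivity
  have hκ4 : κ ^ 2 ≤ 1 / 4 := by nlinarith
  rcases le_or_gt s (1 / 2) with h | h
  · -- swap slab and line zone: `Q = δ s`
    rw [qTilde_of_le a κ δ h] at hQ
    have hQs : Q / δ = s := by rw [hQ]; field_simp
    have hPle : P ≤ 5 * κ ^ 2 / 8 := hP ▸ pFun_le h
    refine ⟨by nlinarith, ?_, by nlinarith⟩
    rcases le_or_gt s (1 / 4) with h4 | h4
    · rw [modelHFun_of_le hδ (by rw [hQ]; nlinarith), hQs, hP, sub_self]
    · rw [pFun_of_ge κ h4.le] at hP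
      rw [modelHFun_line hκ hδ (by rw [hQ]; nlinarith) (by rw [hP]; nlinarith), hP, hQ]
      have : δ * (κ ^ 2 * s) / κ ^ 2 - s * δ = 0 := by field_simp; ring
      rw [this, mul_zero]
  · -- top zone: `P = κ² s`, `Q = 𝒸(P)`
    have hs14 : 1 / 4 ≤ s := by linarith
    rw [pFun_of_ge κ hs14] at hP
    have hsP : P / κ ^ 2 = s := by rw [hP]; field_simp
    have hQc : Q = cocoreCurve κ δ P := by
      rw [hQ, sq_qTilde_eq_qHat hκ.ne' hs14, cocoreCurve_eq_qHat a δ P, hsP, hP, mul_one]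
    have hPκ : P < κ ^ 2 := by rw [hP]; nlinarith
    have hP2 : κ ^ 2 / 2 < P := by rw [hP]; nlinarith
    have hc := half_lt_cocoreCurve hκ hδ hP2 (by linarith)
    refine ⟨?_, ?_, hPκ⟩
    · have := cocoreCurve_le_one_sub hκ hκ2 hδ.le hδ2 (P := P); linarith
    · rw [modelHFun_of_ge hδ (by linarith), hQc, sub_self]

/-- **Conversely, `{P + Q ≤ 1, h = 0, P < κ²}` lies on the curve `u = 1`.**
[cite: MilnorHCobordism1965, §3] -/
theorem param_of_seamZero (a : ℝ) {κ δ : ℝ} (hκ : 0 < κ) (hδ : 0 < δ) {P Q : ℝ} (hQ0 : 0 ≤ Q)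
    (hr : P + Q ≤ 1) (h0 : modelHFun κ δ P Q = 0) (hPκ : P < κ ^ 2) :
    ∃ s : ℝ, 0 ≤ s ∧ s < 1 ∧ P = pFun κ s ∧ Q = s * qTilde a κ δ s 1 := by
  have hκ2' : 0 < κ ^ 2 := by positivity
  rcases le_or_gt Q (δ / 4) with hQa | hQa
  · -- swap slab: `s = Q/δ`
    rw [modelHFun_of_le hδ hQa, sub_eq_zero] at h0
    have hs0 : 0 ≤ Q / δ := div_nonneg hQ0 hδ.le
    have hs4 : Q / δ ≤ 1 / 4 := by rw [div_le_iff₀ hδ]; linarith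
    refine ⟨Q / δ, hs0, by linarith, h0, ?_⟩
    rw [qTilde_of_le a κ δ (by linarith)]; field_simp
  rcases le_or_gt (δ / 2) Q with hQb | hQb
  · -- upper zone: `Q = 𝒸(P)`
    rw [modelHFun_of_ge hδ hQb, sub_eq_zero] at h0
    rcases le_or_gt P (κ ^ 2 / 2) with hP2 | hP2
    · -- the corner `(κ²/2, δ/2)`: `s = 1/2`
      rw [cocoreCurve_of_le hκ hP2] at h0
      have hge : δ / 2 ≤ δ * P / κ ^ 2 := h0 ▸ hQb
      rw [le_div_iff₀ hκ2'] at hge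
      have hPe : P = κ ^ 2 / 2 := le_antisymm hP2 (by nlinarith)
      have hQe : Q = δ / 2 := by rw [← h0, hPe]; field_simp
      refine ⟨1 / 2, by norm_num, by norm_num, ?_, ?_⟩
      · rw [pFun_of_ge κ (by norm_num), hPe]; ring
      · rw [qTilde_of_le a κ δ le_rfl, hQe]; ring
    · -- `s = P/κ² ∈ (1/2, 1)`
      have hs1 : P / κ ^ 2 < 1 := by rwa [div_lt_one hκ2']
      have hs2 : 1 / 2 < P / κ ^ 2 := by rw [lt_div_iff₀ hκ2']; linarith
      refine ⟨P / κ ^ 2, by positivity, hs1, ?_, ?_⟩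
      · rw [pFun_of_ge κ (by linarith)]; field_simp
      · rw [sq_qTilde_eq_qHat hκ.ne' (by linarith), ← h0, cocoreCurve_eq_qHat a δ P]
        congr 1
        field_simp
  · -- line zone: a zero forces `P ≤ κ²/2` and `δP = κ²Q`; `s = Q/δ`
    have hP2 : P ≤ κ ^ 2 / 2 := by
      by_contra hlt
      push Not at hlt
      have hc : Q ≤ cocoreCurve κ δ P :=
        (le_min (by linarith) (by rw [le_div_iff₀ hκ2']; nlinarith)).trans (min_le_cocoreCurve κ δ P)
      linarith [modelHFun_pos_of hκ hδ hQa hQb hlt hc]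
    rw [modelHFun_line hκ hδ hQa.le hP2] at h0
    have hm := lineMult_pos hκ hδ (Q / δ)
    have hz : δ * P / κ ^ 2 - Q = 0 := (mul_eq_zero.1 h0).resolve_left hm.ne'
    have h1 : δ * P = Q * κ ^ 2 := by rwa [sub_eq_zero, div_eq_iff hκ2'.ne'] at hz
    have hs4 : 1 / 4 < Q / δ := by rw [lt_div_iff₀ hδ]; linarith
    have hs2 : Q / δ < 1 / 2 := by rw [div_lt_iff₀ hδ]; linarith
    refine ⟨Q / δ, div_nonneg hQ0 hδ.le, by linarith, ?_, ?_⟩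
    · rw [pFun_of_ge κ hs4.le]; field_simp; linarith
    · rw [qTilde_of_le a κ δ hs2.le]; field_simp

end Plane

/-! ### §2 The image of the dual boundary sphere -/

section Sphere

/-- **THE IMAGE OF THE DUAL BOUNDARY SPHERE `∂D⁴ ∖ S` IS THE ZERO SET OF `H` IN THE HANDLE BELOW
`P = κ²`**: `modelF a κ δ '' {‖z‖ = 1, ‖z_λ‖² < 1} = {‖x‖ ≤ 1, H x = 0, ‖x_λ‖² < κ²}`.
[cite: MilnorHCobordism1965, §3] -/
theorem image_modelF_sphere_eq {a κ δ : ℝ} (ha : 0 < a) (hκ : 0 < κ) (hκ2 : κ ≤ 1 / 2) (hδ : 0 < δ)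
    (hδ2 : δ ≤ 1 / 2) :
    modelF a κ δ '' {z | ‖z‖ = 1 ∧ sOf z < 1} =
      {x | ‖x‖ ≤ 1 ∧ modelH κ δ x = 0 ∧ ‖lamPart x‖ ^ 2 < κ ^ 2} := by
  ext x
  constructor
  · rintro ⟨z, ⟨hz, hs⟩, rfl⟩
    have hu := uOf_eq_one_of_norm_eq_one hz hs
    have hP := norm_lamPart_modelF_sq (a := a) (δ := δ) hκ hs
    have hq : 0 < qTilde a κ δ (sOf z) (uOf z) :=
      qTilde_pos ha hκ hκ2 hδ hδ2 (sq_nonneg _) hs (uOf_nonneg hs) (uOf_le_one hz.le hs)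
    have hQ := norm_muPart_modelF_sq hq
    rw [hu, one_mul] at hP
    rw [hu] at hQ
    obtain ⟨hr, h0, hPκ⟩ := seamZero_of_param hκ hκ2 hδ hδ2 hs hP hQ
    exact ⟨(norm_le_one_iff_parts _).2 hr, h0, hPκ⟩
  · rintro ⟨hx, h0, hPκ⟩
    obtain ⟨s, hs0, hs1, hP, hQ⟩ :=
      param_of_seamZero a hκ hδ (sq_nonneg _) ((norm_le_one_iff_parts x).1 hx) h0 hPκ
    obtain ⟨z, hsz, hmz, hzx⟩ :=
      exists_preimage_of_param ha hκ hκ2 hδ hδ2 hs0 hs1 zero_le_one le_rfl (by rw [hP, one_mul]) hQ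
    refine ⟨z, ⟨?_, by rw [hsz]; exact hs1⟩, hzx⟩
    have h := norm_sq_eq_lamPart_muPart z
    rw [show ‖lamPart z‖ ^ 2 = sOf z from rfl, hsz, hmz] at h
    have h1 : ‖z‖ ^ 2 = 1 := by linarith
    exact (pow_eq_one_iff_of_nonneg (norm_nonneg z) two_ne_zero).1 h1

/-- **On the seam, `H < 0` exactly off the plateau**: `‖x‖ = 1`, `‖x_λ‖² < 3κ²/4 ⇒ H x < 0`
(and `H x = 0` for `3κ²/4 ≤ ‖x_λ‖² ≤ 1 - δ/2` by `modelH_eq_one_sub_norm_sq`). [folklore] -/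
theorem modelH_neg_of_seam {κ δ : ℝ} (hκ : 0 < κ) (hκ2 : κ ≤ 1 / 2) (hδ : 0 < δ) (hδ2 : δ ≤ 1 / 2)
    {x : EuclideanSpace ℝ (Fin 4)} (hx : ‖x‖ = 1) (hP : ‖lamPart x‖ ^ 2 < 3 * κ ^ 2 / 4) :
    modelH κ δ x < 0 := by
  have h := norm_sq_eq_lamPart_muPart x
  rw [hx, one_pow] at h
  have hκ2' : 0 < κ ^ 2 := by positivity
  have hκ4 : κ ^ 2 ≤ 1 / 4 := by nlinarith
  have hQ : δ / 2 ≤ ‖muPart x‖ ^ 2 := by linarith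
  rw [modelH_of_ge hδ hQ, cocoreCurve]
  have hs : ‖lamPart x‖ ^ 2 / κ ^ 2 < 3 / 4 := by rw [div_lt_iff₀ hκ2']; linarith
  have hω : shellCut (‖lamPart x‖ ^ 2 / κ ^ 2) < 1 :=
    Real.smoothTransition.lt_one_of_lt_one (by linarith)
  have hω0 := (shellCut_mem (‖lamPart x‖ ^ 2 / κ ^ 2)).1
  have h2 : δ * ‖lamPart x‖ ^ 2 / κ ^ 2 < 1 - ‖lamPart x‖ ^ 2 := by
    rw [div_lt_iff₀ hκ2']; nlinarith
  nlinarith [mul_pos (sub_pos.2 hω) (sub_pos.2 h2)]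

/-- **On the seam the new boundary is the plateau band**: for `‖x‖ = 1`,
`(H x = 0 ∧ ‖x_λ‖² < κ²) ↔ (3κ²/4 ≤ ‖x_λ‖² < κ²)`. [folklore] -/
theorem seamZero_iff_of_norm_eq_one {κ δ : ℝ} (hκ : 0 < κ) (hκ2 : κ ≤ 1 / 2) (hδ : 0 < δ)
    (hδ2 : δ ≤ 1 / 2) {x : EuclideanSpace ℝ (Fin 4)} (hx : ‖x‖ = 1) :
    (modelH κ δ x = 0 ∧ ‖lamPart x‖ ^ 2 < κ ^ 2) ↔
      (3 * κ ^ 2 / 4 ≤ ‖lamPart x‖ ^ 2 ∧ ‖lamPart x‖ ^ 2 < κ ^ 2) := by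
  constructor
  · rintro ⟨h0, hP⟩
    refine ⟨?_, hP⟩
    by_contra hlt
    push Not at hlt
    exact (modelH_neg_of_seam hκ hκ2 hδ hδ2 hx hlt).ne h0
  · rintro ⟨h34, hP⟩
    refine ⟨?_, hP⟩
    have h := norm_sq_eq_lamPart_muPart x
    rw [hx, one_pow] at h
    have hκ4 : κ ^ 2 ≤ 1 / 4 := by nlinarith
    rw [modelH_eq_one_sub_norm_sq hκ hδ h34 (by linarith), hx]; ring

/-- The explicit inverse of the depth profile: `g a (2w/(a + 2w)) = w` (`w ≥ 0`). [folklore] -/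
theorem gProfile_twoMul_div {a w : ℝ} (ha : 0 < a) (hw : 0 ≤ w) : gProfile a (2 * w / (a + 2 * w)) = w := by
  unfold gProfile
  have h1 : a + 2 * w ≠ 0 := by positivity
  have h2 : 1 - 2 * w / (a + 2 * w) = a / (a + 2 * w) := by field_simp; ring
  rw [h2]
  field_simp

/-- **`Dome ⊆ Π(T)`** (with `dualVec_mem_dualDome`: the dome is EXACTLY the image of the dual attaching
map read in the chart): for `x` in the dome, `y = (√(1 - d - P/κ²)·x̂_μ, x_λ/κ)` with
`δ d = g⁻¹(‖x‖² - 1) = 2w/(a + 2w)` is a tube point with `Π y = x`. [cite: MilnorHCobordism1965, §3] -/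
theorem dualDome_subset_range_dualVec {a κ δ : ℝ} (ha : 0 < a) (hκ : 0 < κ) (hκ2 : κ ≤ 1 / 2)
    (hδ : 0 < δ) : dualDome a κ δ ⊆ Set.range (dualVec a κ δ) := by
  rintro x ⟨hP, h1, h2⟩
  have hκ2' : 0 < κ ^ 2 := by positivity
  have hκ4 : κ ^ 2 ≤ 1 / 4 := by nlinarith
  have hxQ : ‖muPart x‖ ^ 2 = ‖x‖ ^ 2 - ‖lamPart x‖ ^ 2 := by rw [norm_sq_eq_lamPart_muPart]; ring
  have hQpos : 0 < ‖muPart x‖ ^ 2 := by rw [hxQ]; nlinarith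
  have hmu : 0 < ‖muPart x‖ := lt_of_le_of_ne (norm_nonneg _) fun h => by
    rw [← h] at hQpos; norm_num at hQpos
  -- the `W`-depth `w = ‖x‖² - 1 = g(t)`, `t = 2w/(a + 2w) < δ(1 - P/κ²)`
  set w := ‖x‖ ^ 2 - 1 with hw
  have hw0 : 0 ≤ w := by linarith
  have haw : 0 < a + 2 * w := by positivity
  set t := 2 * w / (a + 2 * w) with ht
  have ht0 : 0 ≤ t := by positivity
  have ht1 : t < 1 := by rw [ht, div_lt_one haw]; linarith
  have hgt : gProfile a t = w := gProfile_twoMul_div ha hw0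
  have hp2 : ‖lamPart x‖ ^ 2 / κ ^ 2 < 1 := by rwa [div_lt_one hκ2']
  have htd : t < δ * (1 - ‖lamPart x‖ ^ 2 / κ ^ 2) := by
    by_contra hle
    push Not at hle
    have := gProfile_le_gProfile ha hle ht1
    rw [hgt] at this
    linarith
  set d := t / δ with hd
  have hd0 : 0 ≤ d := div_nonneg ht0 hδ.le
  have hd1 : d < 1 - ‖lamPart x‖ ^ 2 / κ ^ 2 := by rw [hd, div_lt_iff₀ hδ]; linarith
  have hδd : δ * d = t := by rw [hd]; field_simp
  -- the tube point `y = (√c · x̂_μ, x_λ/κ)`, `c = 1 - d - P/κ²`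
  set c := 1 - d - ‖lamPart x‖ ^ 2 / κ ^ 2 with hc
  have hc0 : 0 < c := by linarith
  have hsc : 0 < Real.sqrt c := Real.sqrt_pos.2 hc0
  set yl : EuclideanSpace ℝ (Fin 2) := (Real.sqrt c / ‖muPart x‖) • muPart x with hyl
  set ym : EuclideanSpace ℝ (Fin 2) := κ⁻¹ • lamPart x with hym
  have hyl1 : ‖yl‖ = Real.sqrt c := by
    rw [hyl, norm_smul, norm_div, norm_norm, Real.norm_of_nonneg hsc.le, div_mul_cancel₀ _ hmu.ne']
  have hyl2 : ‖yl‖ ^ 2 = c := by rw [hyl1, Real.sq_sqrt hc0.le]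
  have hym2 : ‖ym‖ ^ 2 = ‖lamPart x‖ ^ 2 / κ ^ 2 := by
    rw [hym, norm_smul, norm_inv, Real.norm_of_nonneg hκ.le, mul_pow, inv_pow]; field_simp
  set yv : EuclideanSpace ℝ (Fin 4) := lamEmbed yl + muEmbed ym with hyv
  have hyv2 : ‖yv‖ ^ 2 = 1 - d := by rw [hyv, norm_lamEmbed_add_muEmbed_sq, hyl2, hym2, hc]; ring
  have hyv1 : yv ∈ Metric.closedBall (0 : EuclideanSpace ℝ (Fin 4)) 1 := by
    rw [mem_closedBall_zero_iff]; nlinarith [norm_nonneg yv]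
  have hyvl : lamPart yv = yl := by rw [hyv, lamPart_add, lamPart_lamEmbed, lamPart_muEmbed, add_zero]
  have hlam : lamSq 2 yv ≠ 0 := by rw [← norm_lamPart_sq, hyvl, hyl2]; exact hc0.ne'
  refine ⟨⟨⟨yv, hyv1⟩, hlam⟩, ?_⟩
  set y : ↥(handleTube 3 2) := ⟨⟨yv, hyv1⟩, hlam⟩ with hy
  have hvec : tubeVec y = yv := rfl
  have hfib : tubeFibre y = ym := by
    rw [tubeFibre, hvec, hyv, muPart_add, muPart_lamEmbed, muPart_muEmbed, zero_add]
  have hdep : tubeDepth y = d := by rw [tubeDepth, hvec, hyv2]; ring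
  have hang : (tubeAngle y : EuclideanSpace ℝ (Fin 2)) = ‖muPart x‖⁻¹ • muPart x := by
    rw [coe_tubeAngle, hvec, hyvl, hyl1, hyl, smul_smul]
    congr 1
    field_simp
  have hR : Real.sqrt (1 + gProfile a (δ * tubeDepth y) - κ ^ 2 * ‖tubeFibre y‖ ^ 2) = ‖muPart x‖ := by
    rw [hdep, hδd, hgt, hfib, hym2, mul_div_cancel₀ _ hκ2'.ne',
      show 1 + w - ‖lamPart x‖ ^ 2 = ‖muPart x‖ ^ 2 by rw [hxQ, hw]; ring, Real.sqrt_sq (norm_nonneg _)]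
  rw [dualVec, hR, hfib, hang, hym, smul_smul, mul_inv_cancel₀ hκ.ne', one_smul, muEmbed_smul, smul_smul,
    mul_inv_cancel₀ hmu.ne', one_smul, lamEmbed_add_muEmbed]

/-- **The dome is exactly `Π(T)`.** [cite: MilnorHCobordism1965, §3] -/
theorem dualDome_eq_range_dualVec {a κ δ : ℝ} (ha : 0 < a) (hκ : 0 < κ) (hκ2 : κ ≤ 1 / 2) (hδ : 0 < δ)
    (hδ2 : δ ≤ 1 / 2) : dualDome a κ δ = Set.range (dualVec a κ δ) :=
  (dualDome_subset_range_dualVec ha hκ hκ2 hδ).antisymm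
    (Set.range_subset_iff.2 fun y => dualVec_mem_dualDome ha hκ (by linarith) hδ hδ2 y)

/-- **Registered helper `helper_image_modelF_sphere` (brick (F-bdry) of T3b, sub-goal of NF6
`stub_steinRealisation`, wave 3, lead c5): the image of the dual boundary sphere off `S` is the
zero set of the model function in the handle below `‖x_λ‖² = κ²`.** [cite: MilnorHCobordism1965, §3] -/
theorem helper_image_modelF_sphere : ∀ {a κ δ : ℝ}, 0 < a → 0 < κ → κ ≤ 1 / 2 → 0 < δ → δ ≤ 1 / 2 → Summit.SmoothPoincare4.SmoothPoincare4.Theorems.AcyclicBisectionExists.ModpBraidOrbits.modelF a κ δ '' {z : EuclideanSpace ℝ (Fin 4) | ‖z‖ = 1 ∧ Summit.SmoothPoincare4.SmoothPoincare4.Theorems.AcyclicBisectionExists.ModpBraidOrbits.sOf z < 1} = {x : EuclideanSpace ℝ (Fin 4) | ‖x‖ ≤ 1 ∧ Summit.SmoothPoincare4.SmoothPoincare4.Theorems.AcyclicBisectionExists.ModpBraidOrbits.modelH κ δ x = 0 ∧ ‖Literature.Topology.FourManifolds.lamPart x‖ ^ 2 < κ ^ 2} :=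
  fun ha hκ hκ2 hδ hδ2 => image_modelF_sphere_eq ha hκ hκ2 hδ hδ2

end Sphere

end Summit.SmoothPoincare4.SmoothPoincare4.Theorems.AcyclicBisectionExists.ModpBraidOrbits

end
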